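import Summits.QuantumFields.QCD.Theses.SpectralDefectExtinction
import Summits.QuantumFields.QCD.Theorems.ExtinctionBuildsQCD.Negative.ExtinctIntegrable
import Literature.MathematicalPhysics.QuantumFieldTheory.QCDPhaseQuenchedPositivity

/-!
# `WindowExtinction` (crux stmt-QuantumFields-18063, SD⁺) — negative-side support:
# the extensive pin TIGHT⁺ FORCES an extensive susceptibility FLOOR (FLOOR is necessary)

Line lead of the crux (`prover-line-stmt-QuantumFields-18063-c1-0`, line `Sketch`, 2026-08-17).  Sorry-free,
no definitions, asserts no route item.

The landed sufficiency direction (`SpectralDefectExtinctionTipPricingTightPlusOfMoments.windowExtinction_of_floorCapWitness`)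
says: an admissible capped branched regularisation with EXTINCT, an intensive susceptibility FLOOR
`χ₀ (a_k(2L_k+1))⁴ Z_k ≤ ∫ Q_k(M)² w_k` and a kurtosis CAP inhabits SD⁺.  This file proves the converse half that
every line must respect: **SD⁺ ⇒ the same witness carries the FLOOR with `χ₀ = η²`** —

* `floor_core` — abstract AM–GM step: for a weight `w ≥ 0`, an observable `q` with `q² w` and `w` integrable and a
  level `A > 0`, `A ∫ w ≤ ∫ |q| w` implies `A² ∫ w ≤ ∫ q² w` (pointwise `|q| ≤ q²/(2A) + A/2`).
* `tightPlus_floor` — on the literal route terms: TIGHT⁺ witness data `(reg, M₀, m, η)` give, for every probe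
  `M > M₀`, eventually in `k`, `0 < Z_k` and `η² (a_k(2L_k+1))⁴ Z_k ≤ ∫ Q_k(M)² w_k`, where
  `Q_k(M) = n₋(Γ₅ D_W(U, m_crit(k) − a_k M/Z_k, 1)) − 6(2L_k+1)⁴`, `w_k = ∏_f |det D_W(U, m_f(k), 1)|`, `Z_k = ∫ w_k`
  on the scheme torus at `β_k` (positivity of `Z_k`: Literature `integral_norm_det_diracMatrix_pos_all`).
* `susceptibilityFloor_of_windowExtinction` — hence `WindowExtinction` yields, for each `N_f ∈ {2,3}`, an admissible
  capped branched regularisation with EXTINCT (verbatim) AND the FLOOR, i.e. exactly the hypothesis of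
  `windowExtinction_of_floorCapWitness` minus the kurtosis cap.

READING (power counting, for planners).  By `AFBookkeeping` (landed), `a_k⁴ ≍ β_k^{2b₁/b₀²} e^{−β_k/b₀}` along any
asymptotically scaling scheme, so every proof of SD⁺ proves a NON-PERTURBATIVE ASYMPTOTIC-SCALING LOWER BOUND for the
phase-quenched lattice topological susceptibility, `E₊[Q_k²]/(2L_k+1)⁴ ≥ η² a_k⁴ ≍ e^{−β_k/b₀}` (`1/b₀ = 16π²/(11 − 2N_f/3)
= 16.34 (N_f = 2), 17.55 (N_f = 3)` in the tree's units `β = 2/g₀²`), whereas convexity / Jensen-transport implants of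
an instanton supply at best `e^{−4π²β_k − O(1)} = e^{−39.48 β_k}` per unit lattice volume: the deficit
`e^{−(4π² − 1/b₀)β_k} ≍ a_k^{4(16π²b₀) − 4} = a_k^{5.67 | 5}` is the one-loop fluctuation determinant (charge renormalisation
between the cutoff and the instanton scale), i.e. asymptotic freedom itself, which no technique in print controls
non-perturbatively.

References: Leutwyler–Smilga, Phys. Rev. D 46 (1992) 5607 (`E Q² = χ_t V`); 't Hooft, Phys. Rev. D 14 (1976) 3432
(one-loop instanton density); Lüscher, Comm. Math. Phys. 85 (1982) 39 (dislocations vs. `e^{−β/b₀}` entropy).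
-/

noncomputable section

namespace Summit.QuantumFields.QCD.Theorems.WindowExtinction.Negative

open scoped BigOperators Topology Classical MeasureTheory Matrix ComplexConjugate
open Filter MeasureTheory Matrix
open Literature.MathematicalPhysics.QuantumLattice Literature.MathematicalPhysics.QuantumFieldTheory
  Literature.Probability.LatticeModels
open Summit.QuantumFields.QCD.Theses.SpectralDefectExtinction
open Summit.QuantumFields.QCD.Theorems.ExtinctionBuildsQCD.Negative

section Core

/-- **AM–GM floor step.** For a weight `w ≥ 0` with `w` and `q² w` integrable and a level `A > 0`:
`A ∫ w ≤ ∫ |q| w` implies `A² ∫ w ≤ ∫ q² w` (pointwise `|q| w ≤ (q² w)/(2A) + (A/2) w`, integrate, rearrange). -/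
theorem floor_core {X : Type*} [MeasurableSpace X] (μ : Measure X) {q w : X → ℝ} (hw : ∀ x, 0 ≤ w x)
    (hwi : Integrable w μ) (hq2 : Integrable (fun x => q x ^ 2 * w x) μ) {A : ℝ} (hA : 0 < A)
    (h : A * ∫ x, w x ∂μ ≤ ∫ x, |q x| * w x ∂μ) :
    A ^ 2 * ∫ x, w x ∂μ ≤ ∫ x, q x ^ 2 * w x ∂μ := by
  have h2A : 0 < 2 * A := by positivity
  have hpt : ∀ x, |q x| * w x ≤ (1 / (2 * A)) * (q x ^ 2 * w x) + (A / 2) * w x := by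
    intro x
    have h1 : |q x| ≤ (1 / (2 * A)) * q x ^ 2 + A / 2 := by
      rw [show (1 / (2 * A)) * q x ^ 2 + A / 2 = (q x ^ 2 + A ^ 2) / (2 * A) by field_simp,
        le_div_iff₀ h2A]
      nlinarith [sq_nonneg (|q x| - A), sq_abs (q x)]
    calc |q x| * w x ≤ ((1 / (2 * A)) * q x ^ 2 + A / 2) * w x :=
          mul_le_mul_of_nonneg_right h1 (hw x)
      _ = (1 / (2 * A)) * (q x ^ 2 * w x) + (A / 2) * w x := by ring
  have hint : ∫ x, |q x| * w x ∂μ ≤ ∫ x, ((1 / (2 * A)) * (q x ^ 2 * w x) + (A / 2) * w x) ∂μ :=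
    integral_mono_of_nonneg (Eventually.of_forall fun x => mul_nonneg (abs_nonneg _) (hw x))
      ((hq2.const_mul _).add (hwi.const_mul _)) (Eventually.of_forall hpt)
  rw [integral_add (hq2.const_mul _) (hwi.const_mul _), integral_const_mul, integral_const_mul] at hint
  have key := mul_le_mul_of_nonneg_left (h.trans hint) h2A.le
  have e : 2 * A * ((1 / (2 * A)) * (∫ x, q x ^ 2 * w x ∂μ) + (A / 2) * ∫ x, w x ∂μ) =
      (∫ x, q x ^ 2 * w x ∂μ) + A ^ 2 * ∫ x, w x ∂μ := by
    field_simp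
  rw [e] at key
  nlinarith [key]

end Core

section Lattice

variable {Nf : ℕ}

/-- The index observable is bounded: `|n₋ − 6N⁴| ≤ card + 6N⁴` (a root count is at most the matrix size). -/
theorem abs_index_le (N : ℕ) [NeZero N] (U : GaugeConfig 4 N (Matrix.specialUnitaryGroup (Fin 3) ℂ)) (p : ℝ) :
    |((Multiset.countP (fun z : ℂ => z.re < 0)
        (spinorLift gammaFive * wilsonDirac (fundamentalRep (Fin 3)) U p 1).charpoly.roots : ℝ) -
        6 * (N : ℝ) ^ 4)| ≤
      (Fintype.card (TorusSite 4 N × Fin 3 × Fin 4) : ℝ) + 6 * (N : ℝ) ^ 4 := by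
  set A := spinorLift gammaFive * wilsonDirac (fundamentalRep (Fin 3)) U p 1 with hA
  have h1 : ((Multiset.countP (fun z : ℂ => z.re < 0) A.charpoly.roots : ℕ) : ℝ) ≤
      Fintype.card (TorusSite 4 N × Fin 3 × Fin 4) := by
    exact_mod_cast countP_roots_charpoly_le_card A _
  have h0 : (0 : ℝ) ≤ (Multiset.countP (fun z : ℂ => z.re < 0) A.charpoly.roots : ℕ) := Nat.cast_nonneg _
  have h6 : (0 : ℝ) ≤ 6 * (N : ℝ) ^ 4 := by positivity
  rw [abs_le]
  constructor <;> linarith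

/-- **TIGHT⁺ ⇒ FLOOR, on the literal route terms.**  If witness data `(reg, M₀, m)` satisfy the TIGHT⁺ clause of
SD⁺ with constant `η` (stated verbatim as the hypothesis), then for every probe `M > M₀`, eventually in `k`, the
phase-quenched partition function is positive and `η² (a_k(2L_k+1))⁴ Z_k ≤ ∫ Q_k(M)² w_k` — the susceptibility
FLOOR with `χ₀ = η²` (AM–GM `floor_core`; `Z_k > 0` by `integral_norm_det_diracMatrix_pos_all`). -/
theorem tightPlus_floor (reg : QCDRegularisation Nf) (M₀ : ℝ) (m : Fin Nf → ℝ) {η : ℝ} (hη : 0 < η)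
    (hT : ∀ M : ℝ, M₀ < M → ∀ᶠ k : ℕ in Filter.atTop, max 1 (η * (reg.a k * (2 * reg.L k + 1 : ℝ)) ^ 2) ≤ (∫ U, (|(Multiset.countP (fun z : ℂ => z.re < 0) (spinorLift gammaFive * wilsonDirac (fundamentalRep (Fin 3)) U (reg.mcrit k - reg.a k * M / reg.Zm k) 1).charpoly.roots : ℝ) - 6 * (2 * reg.L k + 1 : ℝ) ^ 4|) * ∏ f : Fin Nf, ‖fermionDet (wilsonDirac (fundamentalRep (Fin 3)) U (reg.mcrit k + reg.a k * m f / reg.Zm k) 1)‖ ∂(wilsonMeasure (d := 4) (L := 2 * reg.L k + 1) (fundamentalRep (Fin 3)) (reg.β k))) / (∫ U, ∏ f : Fin Nf, ‖fermionDet (wilsonDirac (fundamentalRep (Fin 3)) U (reg.mcrit k + reg.a k * m f / reg.Zm k) 1)‖ ∂(wilsonMeasure (d := 4) (L := 2 * reg.L k + 1) (fundamentalRep (Fin 3)) (reg.β k)))) :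
    ∀ M : ℝ, M₀ < M → ∀ᶠ k : ℕ in Filter.atTop,
      0 < (∫ U, ∏ f : Fin Nf, ‖fermionDet (wilsonDirac (fundamentalRep (Fin 3)) U (reg.mcrit k + reg.a k * m f / reg.Zm k) 1)‖ ∂(wilsonMeasure (d := 4) (L := 2 * reg.L k + 1) (fundamentalRep (Fin 3)) (reg.β k))) ∧
        η ^ 2 * (reg.a k * (2 * reg.L k + 1 : ℝ)) ^ 4 * (∫ U, ∏ f : Fin Nf, ‖fermionDet (wilsonDirac (fundamentalRep (Fin 3)) U (reg.mcrit k + reg.a k * m f / reg.Zm k) 1)‖ ∂(wilsonMeasure (d := 4) (L := 2 * reg.L k + 1) (fundamentalRep (Fin 3)) (reg.β k)))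
          ≤ (∫ U, ((Multiset.countP (fun z : ℂ => z.re < 0) (spinorLift gammaFive * wilsonDirac (fundamentalRep (Fin 3)) U (reg.mcrit k - reg.a k * M / reg.Zm k) 1).charpoly.roots : ℝ) - 6 * (2 * reg.L k + 1 : ℝ) ^ 4) ^ 2 * ∏ f : Fin Nf, ‖fermionDet (wilsonDirac (fundamentalRep (Fin 3)) U (reg.mcrit k + reg.a k * m f / reg.Zm k) 1)‖ ∂(wilsonMeasure (d := 4) (L := 2 * reg.L k + 1) (fundamentalRep (Fin 3)) (reg.β k))) := by
  intro M hM
  filter_upwards [hT M hM] with k hk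
  -- abbreviations
  set μ := wilsonMeasure (d := 4) (L := 2 * reg.L k + 1) (fundamentalRep (Fin 3)) (reg.β k) with hμ
  set w : GaugeConfig 4 (2 * reg.L k + 1) (Matrix.specialUnitaryGroup (Fin 3) ℂ) → ℝ :=
    fun U => ∏ f : Fin Nf, ‖fermionDet (wilsonDirac (fundamentalRep (Fin 3)) U (reg.mcrit k + reg.a k * m f / reg.Zm k) 1)‖ with hw
  set q : GaugeConfig 4 (2 * reg.L k + 1) (Matrix.specialUnitaryGroup (Fin 3) ℂ) → ℝ :=
    fun U => (Multiset.countP (fun z : ℂ => z.re < 0) (spinorLift gammaFive * wilsonDirac (fundamentalRep (Fin 3)) U (reg.mcrit k - reg.a k * M / reg.Zm k) 1).charpoly.roots : ℝ) - 6 * (2 * reg.L k + 1 : ℝ) ^ 4 with hq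
  set ℓ : ℝ := reg.a k * (2 * reg.L k + 1 : ℝ) with hℓ
  -- positivity and integrability of the weight (Literature `QCDPhaseQuenched(Positivity)`)
  have hw0 : ∀ U, 0 ≤ w U := fun U => Finset.prod_nonneg fun f _ => norm_nonneg _
  have hZ : 0 < ∫ U, w U ∂μ := by
    have h := integral_norm_det_diracMatrix_pos_all (S := 2 * reg.L k + 1) (reg.β k)
      (fun f : Fin Nf => reg.mcrit k + reg.a k * m f / reg.Zm k)
    refine h.trans_eq (integral_congr_ae (Eventually.of_forall fun U => ?_))
    simp only [hw, norm_det_diracMatrix]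
  have hwi : Integrable w μ := by
    have h := integrable_norm_det_diracMatrix (S := 2 * reg.L k + 1)
      (fun f : Fin Nf => reg.mcrit k + reg.a k * m f / reg.Zm k) μ
    refine h.congr (Eventually.of_forall fun U => ?_)
    simp only [hw, norm_det_diracMatrix]
  -- measurability and boundedness of the index, integrability of `q² w`
  have hqmeas : Measurable q := by
    have h := measurable_negCount (L := 2 * reg.L k + 1) (reg.mcrit k - reg.a k * M / reg.Zm k)
    exact ((measurable_from_nat (f := fun n : ℕ => (n : ℝ))).comp h).sub measurable_const
  have hcast : ((2 * reg.L k + 1 : ℕ) : ℝ) = 2 * (reg.L k : ℝ) + 1 := by push_cast; ring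
  have hqbound : ∀ U, |q U| ≤
      (Fintype.card (TorusSite 4 (2 * reg.L k + 1) × Fin 3 × Fin 4) : ℝ) + 6 * (2 * (reg.L k : ℝ) + 1) ^ 4 := by
    intro U
    have h := abs_index_le (2 * reg.L k + 1) U (reg.mcrit k - reg.a k * M / reg.Zm k)
    rw [hcast] at h
    simpa only [hq] using h
  have hq2 : Integrable (fun U => q U ^ 2 * w U) μ := by
    have h := integrable_mul_weight (L := 2 * reg.L k + 1)
      (fun f : Fin Nf => reg.mcrit k + reg.a k * m f / reg.Zm k) (reg.β k)
      (φ := fun U => q U ^ 2) (hqmeas.pow_const 2)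
      (C := ((Fintype.card (TorusSite 4 (2 * reg.L k + 1) × Fin 3 × Fin 4) : ℝ) +
        6 * (2 * (reg.L k : ℝ) + 1) ^ 4) ^ 2) (fun U => by
          rw [abs_pow, ← sq_abs]
          exact pow_le_pow_left₀ (abs_nonneg _) (by rw [abs_abs]; exact hqbound U) 2)
    simpa only [hw] using h
  -- TIGHT⁺ at `k`: `η ℓ² Z ≤ ∫ |q| w`
  have hℓ0 : 0 < ℓ := mul_pos (reg.a_pos k) (by positivity)
  have hA : 0 < η * ℓ ^ 2 := by positivity
  have hT1 : η * ℓ ^ 2 * ∫ U, w U ∂μ ≤ ∫ U, |q U| * w U ∂μ := by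
    have h1 : η * ℓ ^ 2 ≤ (∫ U, |q U| * w U ∂μ) / ∫ U, w U ∂μ := (le_max_right _ _).trans hk
    exact (le_div_iff₀ hZ).1 h1
  have hfloor := floor_core μ hw0 hwi hq2 hA hT1
  refine ⟨hZ, ?_⟩
  calc η ^ 2 * ℓ ^ 4 * ∫ U, w U ∂μ = (η * ℓ ^ 2) ^ 2 * ∫ U, w U ∂μ := by ring
    _ ≤ ∫ U, q U ^ 2 * w U ∂μ := hfloor

/-- **SD⁺ ⇒ FLOOR witness (necessity of the susceptibility floor).**  `WindowExtinction` yields, for each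
`N_f ∈ {2,3}`, a mass-scaling, asymptotically scaling, polynomially capped, branched regularisation with threshold
`M₀ ≥ 0` and window constant `c > 0` such that every tuple `m > M₀` satisfies EXTINCT (verbatim) AND the intensive
susceptibility FLOOR `∃ χ₀ > 0, ∀ M > M₀, ∀ᶠ k, 0 < Z_k ∧ χ₀ (a_k(2L_k+1))⁴ Z_k ≤ ∫ Q_k(M)² w_k` — literally the
hypothesis of the landed `windowExtinction_of_floorCapWitness` with the kurtosis CAP deleted.  Consequently every proof
of the crux certifies `E₊[Q_k(M)²] ≥ χ₀ (a_k(2L_k+1))⁴`, an asymptotic-scaling lower bound for the phase-quenched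
lattice topological susceptibility (`a_k⁴ ≍ e^{−β_k/b₀}` by `AFBookkeeping`). -/
theorem susceptibilityFloor_of_windowExtinction (h : WindowExtinction) {Nf : ℕ} (hNf : Nf = 2 ∨ Nf = 3) :
    ∃ reg : QCDRegularisation Nf, reg.HasMassScaling ∧ (reg.scheme 0 0 0).HasAsymptoticScaling ∧
      (∃ p : ℕ, ∀ᶠ k : ℕ in Filter.atTop, (reg.L k : ℝ) ≤ (reg.a k)⁻¹ ^ p) ∧
      (∀ᶠ k : ℕ in Filter.atTop, -1 < reg.mcrit k) ∧
      ∃ M₀ : ℝ, 0 ≤ M₀ ∧ ∃ c : ℝ, 0 < c ∧ ∀ m : Fin Nf → ℝ, (∀ f, M₀ < m f) →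
        (∀ ε : ℝ, 0 < ε → ∀ᶠ k : ℕ in Filter.atTop, ∀ S : ℕ, reg.L k ≤ S → (∫ U, ((∑ f : Fin Nf, ((Multiset.countP (fun z : ℂ => z.im = 0 ∧ z.re < -(reg.mcrit k + reg.a k * m f / reg.Zm k)) (wilsonDirac (fundamentalRep (Fin 3)) U 0 1).charpoly.roots : ℝ) + (Multiset.countP (fun z : ℂ => |z.re| < c * (reg.a k * m f / reg.Zm k)) (spinorLift gammaFive * wilsonDirac (fundamentalRep (Fin 3)) U (reg.mcrit k + reg.a k * m f / reg.Zm k) 1).charpoly.roots : ℝ)))) * ∏ f : Fin Nf, ‖fermionDet (wilsonDirac (fundamentalRep (Fin 3)) U (reg.mcrit k + reg.a k * m f / reg.Zm k) 1)‖ ∂(wilsonMeasure (d := 4) (L := 2 * S + 1) (fundamentalRep (Fin 3)) (reg.β k))) / (∫ U, ∏ f : Fin Nf, ‖fermionDet (wilsonDirac (fundamentalRep (Fin 3)) U (reg.mcrit k + reg.a k * m f / reg.Zm k) 1)‖ ∂(wilsonMeasure (d := 4) (L := 2 * S + 1) (fundamentalRep (Fin 3)) (reg.β k))) ≤ ε *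 ((2 * S + 1 : ℝ) / (2 * reg.L k + 1)) ^ 4) ∧
        ∃ χ₀ : ℝ, 0 < χ₀ ∧ ∀ M : ℝ, M₀ < M → ∀ᶠ k : ℕ in Filter.atTop,
          0 < (∫ U, ∏ f : Fin Nf, ‖fermionDet (wilsonDirac (fundamentalRep (Fin 3)) U (reg.mcrit k + reg.a k * m f / reg.Zm k) 1)‖ ∂(wilsonMeasure (d := 4) (L := 2 * reg.L k + 1) (fundamentalRep (Fin 3)) (reg.β k))) ∧
            χ₀ * (reg.a k * (2 * reg.L k + 1 : ℝ)) ^ 4 * (∫ U, ∏ f : Fin Nf, ‖fermionDet (wilsonDirac (fundamentalRep (Fin 3)) U (reg.mcrit k + reg.a k * m f / reg.Zm k) 1)‖ ∂(wilsonMeasure (d := 4) (L := 2 * reg.L k + 1) (fundamentalRep (Fin 3)) (reg.β k)))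
              ≤ (∫ U, ((Multiset.countP (fun z : ℂ => z.re < 0) (spinorLift gammaFive * wilsonDirac (fundamentalRep (Fin 3)) U (reg.mcrit k - reg.a k * M / reg.Zm k) 1).charpoly.roots : ℝ) - 6 * (2 * reg.L k + 1 : ℝ) ^ 4) ^ 2 * ∏ f : Fin Nf, ‖fermionDet (wilsonDirac (fundamentalRep (Fin 3)) U (reg.mcrit k + reg.a k * m f / reg.Zm k) 1)‖ ∂(wilsonMeasure (d := 4) (L := 2 * reg.L k + 1) (fundamentalRep (Fin 3)) (reg.β k))) := by
  obtain ⟨reg, hMS, hAS, hCap, hBr, M₀, hM₀, c, hc, H⟩ := h Nf hNf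
  refine ⟨reg, hMS, hAS, hCap, hBr, M₀, hM₀, c, hc, fun m hm => ⟨(H m hm).1, ?_⟩⟩
  obtain ⟨η, hη, hT⟩ := (H m hm).2
  exact ⟨η ^ 2, by positivity, tightPlus_floor reg M₀ m hη hT⟩

end Lattice

end Summit.QuantumFields.QCD.Theorems.WindowExtinction.Negative

end
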